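import Literature.Geometry.Lorentzian.CarterThresholdCorePoly
import Literature.Geometry.Lorentzian.CarterSliverCapCoefficient
import HarnessLib

/-!
# Bookkeeping for the threshold-sliver kernel bound of Carter's equation: the fuzz, the kernel
# constant and the second depth condition as powers of the master variables
(namespace `Literature.Geometry.Lorentzian.Kerr`.)

Complements `CarterThresholdKernelBookkeeping` / `CarterThresholdCorePoly` for the sliver case
`0 < |σ| ≤ 2ξ₁κ` (`σ = ω − mω₊`, `ξ₁ ≤ 1/2`) of `CarterSliverRegimeKernel.sliverRegime_kernel_le`:

* `sliverFuzz_le` — `E* ≤ 256ξ₁²/θ₁² + 68ξ₁M|ω|/θ₁` (`|S| ≤ ξ₁(r₊ − r₋)`, `r₊ + r₋ = 2M`, `ζ = θ₁M/8`),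
  hence `E* ≤ 98W³` and `f = 1 + 25E*/θ₁ ≤ 2451W⁴` for any `W ≥ 1` dominating `θ₁⁻¹, M, |ω|`;
* `sliverKernelConstant_le_pow` — the constant of `sliverRegime_kernel_le` is `≤ c_K′·Y¹²⁴` once
  `P_I² ≤ c_P Y¹⁰⁹`, `P_I′² ≤ c_P′ Y¹⁰⁵`, `A₀ ≤ 93312Y¹⁶`, `f ≤ 2451Y⁴`;
* `sliverDepth2_of_large` — the second depth condition
  `96((P_I + 829440f P_I′/(θ₁²ω²M))e)√|σω| ≤ |ω|cosh((θ₁/3)⁴√Λ′/256)` follows from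
  `c_D Z¹¹⁶ ≤ sinh((θ₁/3)⁴√Λ/4096)` in the κ-free master variable `Z = 32(1 + M + M⁻¹)⁴(1 + θ₁⁻¹)Λ`.

Elementary monomial arithmetic (near-extremal Kerr programme, crux `KappaExplicitWaveDecay`).

## References
* M. Dafermos, I. Rodnianski, Y. Shlapentokh-Rothman, arXiv:1402.7034 = Ann. of Math. 183 (2016),
  §8 (key `DafermosRodnianskiShlapentokhrothman2014`). Folklore arithmetic.
-/

noncomputable section

open Set

namespace Literature.Geometry.Lorentzian

namespace Kerr

section SliverBookkeeping

variable {M a ω θ₁ ξ₁ Y Z Λ : ℝ} {m : ℤ}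

/-- **The fuzz of the sliver is small and polynomial.** For `|a| < M`, `0 < θ₁ ≤ 1`, `0 ≤ ξ₁`,
`|ω − mω₊| ≤ 2ξ₁κ`:
`E* := S²/ζ² + 2|S||ω|(1 + (r₊ + r₋)/ζ) ≤ 256ξ₁²/θ₁² + 68ξ₁M|ω|/θ₁` (`S = (r₊² + a²)(ω − mω₊)`,
`ζ = θ₁M/8`). [folklore] -/
theorem sliverFuzz_le (hMa : IsSubextremal M a) (hθ₁ : 0 < θ₁) (hθ₁1 : θ₁ ≤ 1) (hξ₁ : 0 ≤ ξ₁)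
    (hσ : |ω - m * horizonAngularVelocity M a| ≤ 2 * ξ₁ * surfaceGravity M a) :
    ((rPlus M a ^ 2 + a ^ 2) * (ω - m * horizonAngularVelocity M a)) ^ 2 / (θ₁ * M / 8) ^ 2 +
      2 * |(rPlus M a ^ 2 + a ^ 2) * (ω - m * horizonAngularVelocity M a)| * |ω| *
        (1 + (rPlus M a + rMinus M a) / (θ₁ * M / 8)) ≤
      256 * ξ₁ ^ 2 / θ₁ ^ 2 + 68 * ξ₁ * M * |ω| / θ₁ := by
  have ha : |a| < M := hMa
  have hM : 0 < M := hMa.pos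
  have hrp : 0 < rPlus M a := rPlus_pos hM a
  have hκ : 0 < surfaceGravity M a := hMa.surfaceGravity_pos
  have hAp : 0 < rPlus M a ^ 2 + a ^ 2 := by positivity
  have hd := rPlus_sub_rMinus_eq_mul_surfaceGravity (a := a) hM
  have hsum : rPlus M a + rMinus M a = 2 * M := by unfold rPlus rMinus; ring
  have hr2M : rPlus M a ≤ 2 * M := rPlus_le_two_mul_self hM.le a
  have hrm0 : 0 ≤ rMinus M a := rMinus_nonneg_of_abs_le ha.le
  have hdle : rPlus M a - rMinus M a ≤ 2 * M := by linarith
  set S := (rPlus M a ^ 2 + a ^ 2) * (ω - m * horizonAngularVelocity M a) with hS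
  -- `|S| ≤ ξ₁ (r₊ − r₋) ≤ 2ξ₁M`
  have hSle : |S| ≤ ξ₁ * (rPlus M a - rMinus M a) := by
    rw [hS, abs_mul, abs_of_pos hAp, hd]
    have := mul_le_mul_of_nonneg_left hσ hAp.le
    nlinarith only [this]
  have hS2M : |S| ≤ 2 * ξ₁ * M := hSle.trans (by nlinarith only [hdle, hξ₁])
  have hS0 : 0 ≤ |S| := abs_nonneg _
  -- first term
  have h1 : S ^ 2 / (θ₁ * M / 8) ^ 2 ≤ 256 * ξ₁ ^ 2 / θ₁ ^ 2 := by
    rw [div_le_div_iff₀ (by positivity) (by positivity), ← sq_abs]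
    have : |S| ^ 2 ≤ (2 * ξ₁ * M) ^ 2 := pow_le_pow_left₀ hS0 hS2M 2
    nlinarith only [this, sq_nonneg θ₁, hM]
  -- second term: `1 + (r₊ + r₋)/ζ = 1 + 16/θ₁ ≤ 17/θ₁`
  have h2 : 2 * |S| * |ω| * (1 + (rPlus M a + rMinus M a) / (θ₁ * M / 8)) ≤ 68 * ξ₁ * M * |ω| / θ₁ := by
    rw [hsum]
    have e : 1 + 2 * M / (θ₁ * M / 8) = 1 + 16 / θ₁ := by field_simp; ring
    rw [e]
    have h3 : 1 + 16 / θ₁ ≤ 17 / θ₁ := by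
      have h5 : (1:ℝ) ≤ 1 / θ₁ := by rw [le_div_iff₀ hθ₁]; linarith
      have e2 : 17 / θ₁ = 16 / θ₁ + 1 / θ₁ := by ring
      linarith
    have h4 : 2 * |S| * |ω| * (1 + 16 / θ₁) ≤ 2 * (2 * ξ₁ * M) * |ω| * (17 / θ₁) := by
      gcongr
    calc _ ≤ 2 * (2 * ξ₁ * M) * |ω| * (17 / θ₁) := h4
      _ = 68 * ξ₁ * M * |ω| / θ₁ := by ring
  linarith only [h1, h2]

/-- Polynomial form: with `ξ₁ ≤ 1/2` and `W ≥ 1`, `θ₁⁻¹ ≤ W`, `M ≤ W`, `|ω| ≤ W`: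
`256ξ₁²/θ₁² + 68ξ₁M|ω|/θ₁ ≤ 98W³` and `1 + 25(256ξ₁²/θ₁² + 68ξ₁M|ω|/θ₁)/θ₁ ≤ 2451W⁴`. [folklore] -/
theorem sliverFuzz_le_pow {W : ℝ} (hW : 1 ≤ W) (hθ₁ : 0 < θ₁) (hθ₁i : θ₁⁻¹ ≤ W) (hM : 0 ≤ M)
    (hMW : M ≤ W) (hωW : |ω| ≤ W) (hξ₁ : 0 ≤ ξ₁) (hξ₁1 : ξ₁ ≤ 1 / 2) :
    256 * ξ₁ ^ 2 / θ₁ ^ 2 + 68 * ξ₁ * M * |ω| / θ₁ ≤ 98 * W ^ 3 ∧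
    1 + 25 * (256 * ξ₁ ^ 2 / θ₁ ^ 2 + 68 * ξ₁ * M * |ω| / θ₁) / θ₁ ≤ 2451 * W ^ 4 := by
  have hW0 : 0 < W := by linarith
  have hθi : 1 / θ₁ ≤ W := by rw [one_div]; exact hθ₁i
  have h1 : 256 * ξ₁ ^ 2 / θ₁ ^ 2 ≤ 64 * W ^ 2 := by
    have e : 256 * ξ₁ ^ 2 / θ₁ ^ 2 = 256 * ξ₁ ^ 2 * (1 / θ₁) ^ 2 := by field_simp
    rw [e]
    have : ξ₁ ^ 2 ≤ 1 / 4 := by nlinarith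
    have : (1 / θ₁) ^ 2 ≤ W ^ 2 := pow_le_pow_left₀ (by positivity) hθi 2
    nlinarith
  have h2 : 68 * ξ₁ * M * |ω| / θ₁ ≤ 34 * W ^ 3 := by
    have e : 68 * ξ₁ * M * |ω| / θ₁ = 68 * ξ₁ * (M * |ω| * (1 / θ₁)) := by field_simp
    rw [e]
    have hP : M * |ω| * (1 / θ₁) ≤ W * W * W :=
      mul_le_mul (mul_le_mul hMW hωW (abs_nonneg _) hW0.le) hθi (by positivity) (by positivity)
    calc 68 * ξ₁ * (M * |ω| * (1 / θ₁)) ≤ 68 * (1 / 2) * (W * W * W) := by gcongr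
      _ = 34 * W ^ 3 := by ring
  have hW23 : W ^ 2 ≤ W ^ 3 := pow_le_pow_right₀ hW (by norm_num)
  have hE : 256 * ξ₁ ^ 2 / θ₁ ^ 2 + 68 * ξ₁ * M * |ω| / θ₁ ≤ 98 * W ^ 3 := by linarith
  refine ⟨hE, ?_⟩
  have hE0 : 0 ≤ 256 * ξ₁ ^ 2 / θ₁ ^ 2 + 68 * ξ₁ * M * |ω| / θ₁ := by positivity
  have h3 : 25 * (256 * ξ₁ ^ 2 / θ₁ ^ 2 + 68 * ξ₁ * M * |ω| / θ₁) / θ₁ ≤ 25 * (98 * W ^ 3) * W := by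
    rw [div_eq_mul_one_div]
    exact mul_le_mul (by linarith) hθi (by positivity) (by positivity)
  have hW4 : (1:ℝ) ≤ W ^ 4 := one_le_pow₀ hW
  nlinarith [h3, hW4]

/-- **The sliver kernel constant is a power of the master variable.** [folklore] -/
theorem sliverKernelConstant_le_pow (hY : 1 ≤ Y) (hω0 : 0 < |ω|) (hωi : |ω|⁻¹ ≤ Y) (hM : 0 < M)
    (hMi : M⁻¹ ≤ Y) (hθ₁ : 0 < θ₁) (hθ₁i : θ₁⁻¹ ≤ Y) {PI PI' A₀ f : ℝ}
    (hPI : PI ^ 2 ≤ (676 + 1e4 * (8 * 678 * (7e4) ^ 16)) * Y ^ 109)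
    (hPI' : PI' ^ 2 ≤ (2 + 8 * 678 * (7e4) ^ 16) * Y ^ 105) (hA₀0 : 0 ≤ A₀) (hA₀ : A₀ ≤ 93312 * Y ^ 16)
    (hf0 : 0 ≤ f) (hf : f ≤ 2451 * Y ^ 4) :
    12 * (12 * (25 / 7 * (8 * A₀ / (θ₁ * M) + Real.sqrt A₀)) +
        24 * ((PI + 829440 * f / (θ₁ ^ 2 * ω ^ 2 * M) * PI') * Real.exp 1) ^ 2 / |ω| +
          Real.sqrt A₀ / 2) ≤
      (6e9 + 4608 * ((676 + 1e4 * (8 * 678 * (7e4) ^ 16)) +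
        (829440 * 2451) ^ 2 * (2 + 8 * 678 * (7e4) ^ 16))) * Y ^ 124 := by
  have hY0 : 0 < Y := by linarith
  set cB : ℝ := 8 * 678 * (7e4) ^ 16 with hcB
  set cP : ℝ := 676 + 1e4 * cB with hcP
  set cP' : ℝ := 2 + cB with hcP'
  have hcB0 : 0 ≤ cB := by positivity
  have hcP0 : 0 ≤ cP := by positivity
  have hcP'0 : 0 ≤ cP' := by positivity
  have hY16 : (1 : ℝ) ≤ Y ^ 16 := one_le_pow₀ hY
  have hsq : Real.sqrt A₀ ≤ 93313 * Y ^ 16 := by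
    have h1 : Real.sqrt A₀ ≤ A₀ + 1 := by
      rw [Real.sqrt_le_left (by positivity)]; nlinarith
    linarith
  -- first summand `≤ 4.4e8 Y^18`
  have h1 : 12 * (25 / 7 * (8 * A₀ / (θ₁ * M) + Real.sqrt A₀)) ≤ 4.4e8 * Y ^ 18 := by
    have h2 : 8 * A₀ / (θ₁ * M) ≤ 746496 * Y ^ 18 := by
      rw [div_eq_mul_inv, mul_inv]
      calc 8 * A₀ * (θ₁⁻¹ * M⁻¹) ≤ 8 * (93312 * Y ^ 16) * (Y * Y) := by
            apply mul_le_mul (by linarith) (mul_le_mul hθ₁i hMi (by positivity) hY0.le) (by positivity)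
              (by positivity)
        _ = 746496 * Y ^ 18 := by ring
    have h3 : Y ^ 16 ≤ Y ^ 18 := pow_le_pow_right₀ hY (by norm_num)
    nlinarith [h2, hsq, h3]
  -- second summand
  have h2 : 24 * ((PI + 829440 * f / (θ₁ ^ 2 * ω ^ 2 * M) * PI') * Real.exp 1) ^ 2 / |ω| ≤
      192 * (2 * cP + 2 * (829440 * 2451) ^ 2 * cP') * Y ^ 124 := by
    set c := 829440 * f / (θ₁ ^ 2 * ω ^ 2 * M) with hc
    have hc0 : 0 ≤ c := by positivity
    have hcY : c ≤ 829440 * 2451 * Y ^ 9 := by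
      have e : c = 829440 * f * (θ₁⁻¹ ^ 2 * |ω|⁻¹ ^ 2 * M⁻¹) := by
        rw [hc, inv_pow, inv_pow, sq_abs]; field_simp
      rw [e]
      have h5 : θ₁⁻¹ ^ 2 * |ω|⁻¹ ^ 2 * M⁻¹ ≤ Y ^ 2 * Y ^ 2 * Y :=
        mul_le_mul (mul_le_mul (pow_le_pow_left₀ (by positivity) hθ₁i 2)
          (pow_le_pow_left₀ (by positivity) hωi 2) (by positivity) (by positivity)) hMi
          (by positivity) (by positivity)
      calc 829440 * f * (θ₁⁻¹ ^ 2 * |ω|⁻¹ ^ 2 * M⁻¹) ≤ 829440 * (2451 * Y ^ 4) * (Y ^ 2 * Y ^ 2 * Y) := by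
            apply mul_le_mul (by linarith) h5 (by positivity) (by positivity)
        _ = 829440 * 2451 * Y ^ 9 := by ring
    have hsum : (PI + c * PI') ^ 2 ≤ (2 * cP + 2 * (829440 * 2451) ^ 2 * cP') * Y ^ 123 := by
      have e1 : (PI + c * PI') ^ 2 ≤ 2 * PI ^ 2 + 2 * (c ^ 2 * PI' ^ 2) := by
        nlinarith [sq_nonneg (PI - c * PI')]
      have e2 : c ^ 2 * PI' ^ 2 ≤ (829440 * 2451 * Y ^ 9) ^ 2 * (cP' * Y ^ 105) :=
        mul_le_mul (pow_le_pow_left₀ hc0 hcY 2) hPI' (by positivity) (by positivity)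
      have e3 : Y ^ 109 ≤ Y ^ 123 := pow_le_pow_right₀ hY (by norm_num)
      have e4 : (829440 * 2451 * Y ^ 9) ^ 2 * (cP' * Y ^ 105) = (829440 * 2451) ^ 2 * cP' * Y ^ 123 := by ring
      nlinarith [e1, e2, e3, e4, hPI, mul_le_mul_of_nonneg_left e3 hcP0]
    have hexp : Real.exp 1 ^ 2 ≤ 8 := by
      have h := Real.exp_one_lt_d9
      nlinarith [Real.exp_pos 1]
    have h3 : ((PI + c * PI') * Real.exp 1) ^ 2 ≤ (2 * cP + 2 * (829440 * 2451) ^ 2 * cP') * Y ^ 123 * 8 := by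
      rw [mul_pow]
      exact mul_le_mul hsum hexp (by positivity) (by positivity)
    rw [mul_div_assoc, div_eq_mul_inv]
    calc 24 * (((PI + c * PI') * Real.exp 1) ^ 2 * |ω|⁻¹)
        ≤ 24 * ((2 * cP + 2 * (829440 * 2451) ^ 2 * cP') * Y ^ 123 * 8 * Y) := by
          apply mul_le_mul_of_nonneg_left _ (by norm_num)
          exact mul_le_mul h3 hωi (by positivity) (by positivity)
      _ = 192 * (2 * cP + 2 * (829440 * 2451) ^ 2 * cP') * Y ^ 124 := by ring
  -- third summand and assembly
  have h3 : 12 * (Real.sqrt A₀ / 2) ≤ 6e5 * Y ^ 124 := by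
    have : Y ^ 16 ≤ Y ^ 124 := pow_le_pow_right₀ hY (by norm_num)
    nlinarith [hsq, this]
  have h4 : 4.4e8 * Y ^ 18 ≤ 4.4e8 * Y ^ 124 := by
    have : Y ^ 18 ≤ Y ^ 124 := pow_le_pow_right₀ hY (by norm_num)
    linarith
  have e : (6e9 + 4608 * (cP + (829440 * 2451) ^ 2 * cP')) * Y ^ 124 =
      (6e9 - 6e5) * Y ^ 124 + 12 * (192 * (2 * cP + 2 * (829440 * 2451) ^ 2 * cP') * Y ^ 124) +
        6e5 * Y ^ 124 := by
    ring
  have e2 : 12 * (12 * (25 / 7 * (8 * A₀ / (θ₁ * M) + Real.sqrt A₀)) +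
      24 * ((PI + 829440 * f / (θ₁ ^ 2 * ω ^ 2 * M) * PI') * Real.exp 1) ^ 2 / |ω| + Real.sqrt A₀ / 2) =
      12 * (12 * (25 / 7 * (8 * A₀ / (θ₁ * M) + Real.sqrt A₀))) +
      12 * (24 * ((PI + 829440 * f / (θ₁ ^ 2 * ω ^ 2 * M) * PI') * Real.exp 1) ^ 2 / |ω|) +
      12 * (Real.sqrt A₀ / 2) := by ring
  rw [e, e2]
  have hY124 : 0 ≤ Y ^ 124 := by positivity
  linarith [h1, h2, h3, h4, hY124]


/-- **The second depth condition of the sliver from `sinh(c√Λ) ≥ poly(Λ)`.** In the κ-free master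
variable `Z = 32(1 + M + M⁻¹)⁴(1 + θ₁⁻¹)Λ`: if
`288c_E·Z¹¹⁶ ≤ sinh((θ₁/3)⁴√Λ/4096)` (`c_E = 1 + c_P + 829440·2451(1 + c_P′)`), `Λ/256 ≤ Λ′`,
`|σ| ≤ 2ξ₁κ` (`ξ₁ ≤ 1/2`) and `f ≤ 1 + 25(256ξ₁²/θ₁² + 68ξ₁M|ω|/θ₁)/θ₁`, then
`96((P_I + 829440f P_I′/(θ₁²ω²M))e)√|σω| ≤ |ω|cosh((θ₁/3)⁴√Λ′/256)`. [folklore] -/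
theorem sliverDepth2_of_large (hMa : IsSubextremal M a) (ha : M / 2 ≤ |a|)
    (hadm : IsAdmissibleTriple a ω m Λ) (hm : 0 < m) {ε₀ Λ' f : ℝ} (hε₀ : ε₀ ≤ 1 / (16 * M))
    (hcone : |ω - m * horizonAngularVelocity M a| ≤ ε₀ * |(m : ℝ)|) (hθ₁ : 0 < θ₁) (hθ₁1 : θ₁ ≤ 1)
    (hξ₁ : 0 ≤ ξ₁) (hξ₁1 : ξ₁ ≤ 1 / 2)
    (hσ : |ω - m * horizonAngularVelocity M a| ≤ 2 * ξ₁ * surfaceGravity M a)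
    (hΛ' : Λ / 256 ≤ Λ') (hf0 : 0 ≤ f)
    (hfle : f ≤ 1 + 25 * (256 * ξ₁ ^ 2 / θ₁ ^ 2 + 68 * ξ₁ * M * |ω| / θ₁) / θ₁)
    (hsinh : 288 * (1 + (676 + 1e4 * (8 * 678 * (7e4) ^ 16)) +
        829440 * 2451 * (1 + (2 + 8 * 678 * (7e4) ^ 16))) *
        (32 * (1 + M + M⁻¹) ^ 4 * (1 + θ₁⁻¹)) ^ 116 * Λ ^ 116 ≤
      Real.sinh ((θ₁ / 3) ^ 4 / 4096 * Real.sqrt Λ))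
    {R B PI PI' : ℝ} (hRdef : R = max (7 * M) (max (Real.sqrt (12 * Λ) / |ω|) (1 / (M * ω ^ 2))))
    (hBdef : B = ((ω ^ 2 + 6 * Λ / M ^ 2) / (θ₁ / (100 * M)) ^ 2) ^ 16 *
      Real.exp (2 * (θ₁ / (100 * M)) * (50 * M ^ 2 / (θ₁ * M / 2))) *
      ((θ₁ / (100 * M)) ^ 2 * (2 + 2 * |ω| * R) ^ 2 + 2 * ω ^ 2))
    (hPIdef : PI = Real.sqrt ((2 + 2 * |ω| * R) ^ 2 + B / (θ₁ / (100 * M)) ^ 2))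
    (hPI'def : PI' = Real.sqrt (2 * ω ^ 2 + B)) :
    96 * ((PI + 829440 * f / (θ₁ ^ 2 * ω ^ 2 * M) * PI') * Real.exp 1) *
        Real.sqrt |(ω - m * horizonAngularVelocity M a) * ω| ≤
      |ω| * Real.cosh ((θ₁ / 3) ^ 4 * Real.sqrt Λ' / 256) := by
  have haM : |a| ≤ M := le_of_lt hMa
  have hM : 0 < M := hMa.pos
  set cB : ℝ := 8 * 678 * (7e4) ^ 16 with hcBdef
  set cP : ℝ := 676 + 1e4 * cB with hcPdef
  set cP' : ℝ := 2 + cB with hcP'def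
  set cE : ℝ := 1 + cP + 829440 * 2451 * (1 + cP') with hcE
  have hcB0 : 0 ≤ cB := by positivity
  have hcE0 : 0 < cE := by rw [hcE]; positivity
  -- the κ-free master variable
  obtain ⟨hZ1, hωZ, hωiZ, hΛZ, hMZ, hMiZ, hM2iZ, hθ₁Z⟩ := freeMaster_bounds hM haM ha hadm hm hε₀ hcone hθ₁
  set Z := 32 * (1 + M + M⁻¹) ^ 4 * (1 + θ₁⁻¹) * Λ with hZdef
  have hZ116 : Z ^ 116 = (32 * (1 + M + M⁻¹) ^ 4 * (1 + θ₁⁻¹)) ^ 116 * Λ ^ 116 := by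
    rw [hZdef, mul_pow]
  rw [mul_assoc (288 * cE), ← hZ116] at hsinh
  clear hZ116
  clear_value cB cP cP' cE Z
  have hZ0 : 0 < Z := by linarith only [hZ1]
  have hm1 : (1 : ℝ) ≤ m := by exact_mod_cast hm
  have hΛ1 : 1 ≤ Λ := by nlinarith only [hadm.sq_le, hm1]
  have hω0 : 0 < |ω| := by
    have := (cone_abs_omega_le_div hM haM ha hadm hm hε₀ hcone).1
    exact lt_of_lt_of_le (by positivity) this
  -- atoms
  have hR0 : 0 ≤ R := by rw [hRdef]; exact le_trans (by positivity) (le_max_left _ _)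
  have hR : R ≤ 12 * Z ^ 3 := by rw [hRdef]; exact farRadius_le_pow hZ1 hΛ1 hΛZ hMZ hMiZ hω0 hωiZ
  have hB : B ≤ 8 * 678 * (7e4) ^ 16 * Z ^ 105 := by
    rw [hBdef]
    exact farConstant_B_le_pow hZ1 hM hθ₁ hθ₁1 hωZ hΛZ (by linarith only [hΛ1]) hM2iZ hθ₁Z hMZ hR0 hR
  obtain ⟨hPI2, hPI'2⟩ := farEnvelope_sq_le_pow hZ1 hM hθ₁ hθ₁1 hωZ hM2iZ hθ₁Z hMZ hR0 hR hB
  rw [← hcBdef] at hPI2 hPI'2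
  rw [← hcPdef] at hPI2
  rw [← hcP'def] at hPI'2
  have hB0 : 0 ≤ B := by rw [hBdef]; positivity
  have hE0 : 0 ≤ (2 + 2 * |ω| * R) ^ 2 + B / (θ₁ / (100 * M)) ^ 2 := by positivity
  have hE'0 : 0 ≤ 2 * ω ^ 2 + B := by positivity
  have hPIsq : PI ^ 2 ≤ cP * Z ^ 109 := by rw [hPIdef, Real.sq_sqrt hE0]; exact hPI2
  have hPI'sq : PI' ^ 2 ≤ cP' * Z ^ 105 := by rw [hPI'def, Real.sq_sqrt hE'0]; exact hPI'2
  have hPI0 : 0 ≤ PI := by rw [hPIdef]; exact Real.sqrt_nonneg _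
  have hPI'0 : 0 ≤ PI' := by rw [hPI'def]; exact Real.sqrt_nonneg _
  have hcP0 : 0 ≤ cP := le_trans (sq_nonneg _) (le_trans hPIsq (le_of_eq rfl)) |> fun _ ↦ by
    nlinarith only [hPIsq, sq_nonneg PI, pow_pos hZ0 109]
  -- `P_I ≤ (1 + c_P) Z^109`, `P_I′ ≤ (1 + c_P′) Z^105`
  have hZ109 : (1:ℝ) ≤ Z ^ 109 := one_le_pow₀ hZ1
  have hZ105 : (1:ℝ) ≤ Z ^ 105 := one_le_pow₀ hZ1
  have hPIle : PI ≤ (1 + cP) * Z ^ 109 := by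
    have h1 : PI ≤ PI ^ 2 + 1 := by nlinarith only [sq_nonneg (PI - 1), hPI0]
    nlinarith only [h1, hPIsq, hZ109, hcP0]
  have hcP'0 : 0 ≤ cP' := by nlinarith only [hPI'sq, sq_nonneg PI', pow_pos hZ0 105]
  have hPI'le : PI' ≤ (1 + cP') * Z ^ 105 := by
    have h1 : PI' ≤ PI' ^ 2 + 1 := by nlinarith only [sq_nonneg (PI' - 1), hPI'0]
    nlinarith only [h1, hPI'sq, hZ105, hcP'0]
  -- `f ≤ 2451 Z⁴` and the coefficient `c ≤ 829440·2451 Z⁹`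
  obtain ⟨-, hf4⟩ := sliverFuzz_le_pow (ω := ω) hZ1 hθ₁ hθ₁Z hM.le hMZ hωZ hξ₁ hξ₁1
  have hf : f ≤ 2451 * Z ^ 4 := hfle.trans hf4
  set c := 829440 * f / (θ₁ ^ 2 * ω ^ 2 * M) with hc
  have hc0 : 0 ≤ c := by positivity
  have hcZ : c ≤ 829440 * 2451 * Z ^ 9 := by
    have e : c = 829440 * f * (θ₁⁻¹ ^ 2 * |ω|⁻¹ ^ 2 * M⁻¹) := by
      rw [hc, inv_pow, inv_pow, sq_abs]; field_simp
    rw [e]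
    have h5 : θ₁⁻¹ ^ 2 * |ω|⁻¹ ^ 2 * M⁻¹ ≤ Z ^ 2 * Z ^ 2 * Z :=
      mul_le_mul (mul_le_mul (pow_le_pow_left₀ (by positivity) hθ₁Z 2)
        (pow_le_pow_left₀ (by positivity) hωiZ 2) (by positivity) (by positivity)) hMiZ
        (by positivity) (by positivity)
    calc 829440 * f * (θ₁⁻¹ ^ 2 * |ω|⁻¹ ^ 2 * M⁻¹) ≤ 829440 * (2451 * Z ^ 4) * (Z ^ 2 * Z ^ 2 * Z) := by
          apply mul_le_mul (by linarith) h5 (by positivity) (by positivity)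
      _ = 829440 * 2451 * Z ^ 9 := by ring
  -- `P_I + c P_I′ ≤ c_E Z^114`
  have hsum : PI + c * PI' ≤ cE * Z ^ 114 := by
    have h1 : c * PI' ≤ 829440 * 2451 * Z ^ 9 * ((1 + cP') * Z ^ 105) :=
      mul_le_mul hcZ hPI'le hPI'0 (by positivity)
    have h2 : Z ^ 109 ≤ Z ^ 114 := pow_le_pow_right₀ hZ1 (by norm_num)
    have h3 : (1 + cP) * Z ^ 109 ≤ (1 + cP) * Z ^ 114 := mul_le_mul_of_nonneg_left h2 (by positivity)
    have e : 829440 * 2451 * Z ^ 9 * ((1 + cP') * Z ^ 105) = 829440 * 2451 * (1 + cP') * Z ^ 114 := by ring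
    rw [hcE]
    nlinarith only [hPIle, h1, h3, e]
  -- `√|σω| ≤ Z` (`|σ| ≤ κ ≤ 1/(4M) ≤ Z`, `|ω| ≤ Z`)
  have hκ4 : surfaceGravity M a ≤ 1 / (4 * M) := surfaceGravity_le hM a
  have hσZ : |ω - m * horizonAngularVelocity M a| ≤ Z := by
    have h1 : 2 * ξ₁ * surfaceGravity M a ≤ 1 * (1 / (4 * M)) :=
      mul_le_mul (by linarith) hκ4 hMa.surfaceGravity_pos.le zero_le_one
    have h2 : 1 / (4 * M) ≤ M⁻¹ := by rw [one_div, inv_le_inv₀ (by positivity) hM]; linarith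
    linarith only [hσ, h1, h2, hMiZ]
  have hsq : Real.sqrt |(ω - m * horizonAngularVelocity M a) * ω| ≤ Z := by
    rw [Real.sqrt_le_left hZ0.le, abs_mul]
    calc |ω - m * horizonAngularVelocity M a| * |ω| ≤ Z * Z :=
          mul_le_mul hσZ hωZ (abs_nonneg _) hZ0.le
      _ = Z ^ 2 := by ring
  -- the left side `≤ 288 c_E Z^115`
  have hexp : Real.exp 1 ≤ 3 := by have := Real.exp_one_lt_d9; linarith
  have hl : 96 * ((PI + c * PI') * Real.exp 1) * Real.sqrt |(ω - m * horizonAngularVelocity M a) * ω| ≤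
      288 * cE * Z ^ 115 := by
    have h0 : 0 ≤ PI + c * PI' := by positivity
    calc 96 * ((PI + c * PI') * Real.exp 1) * Real.sqrt |(ω - m * horizonAngularVelocity M a) * ω|
        ≤ 96 * ((cE * Z ^ 114) * 3) * Z := by gcongr
      _ = 288 * cE * Z ^ 115 := by ring
  -- the right side `≥ Z⁻¹ sinh((θ₁/3)⁴√Λ/4096)`
  have hΛ0 : 0 ≤ Λ := by linarith only [hΛ1]
  have harg : (θ₁ / 3) ^ 4 / 4096 * Real.sqrt Λ ≤ (θ₁ / 3) ^ 4 * Real.sqrt Λ' / 256 := by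
    have h1 : Real.sqrt Λ / 16 ≤ Real.sqrt Λ' := by
      rw [div_le_iff₀ (by norm_num)]
      calc Real.sqrt Λ = Real.sqrt (Λ / 256 * 16 ^ 2) := by congr 1; ring
        _ = Real.sqrt (Λ / 256) * 16 := by rw [Real.sqrt_mul (by positivity), Real.sqrt_sq (by norm_num)]
        _ ≤ Real.sqrt Λ' * 16 := by gcongr
    have h0 : 0 ≤ (θ₁ / 3) ^ 4 := by positivity
    have := mul_le_mul_of_nonneg_left h1 h0
    have e : (θ₁ / 3) ^ 4 / 4096 * Real.sqrt Λ = (θ₁ / 3) ^ 4 * (Real.sqrt Λ / 16) / 256 := by ring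
    rw [e]; linarith only [this]
  have hcosh : Real.sinh ((θ₁ / 3) ^ 4 / 4096 * Real.sqrt Λ) ≤
      Real.cosh ((θ₁ / 3) ^ 4 * Real.sqrt Λ' / 256) := by
    refine (Real.sinh_le_sinh.2 harg).trans ?_
    exact (Real.sinh_lt_cosh _).le
  have hωlow : Z⁻¹ ≤ |ω| := by rw [inv_le_comm₀ hZ0 hω0]; exact hωiZ
  have hcosh0 : 0 ≤ Real.cosh ((θ₁ / 3) ^ 4 * Real.sqrt Λ' / 256) := (Real.cosh_pos _).le
  calc 96 * ((PI + c * PI') * Real.exp 1) * Real.sqrt |(ω - m * horizonAngularVelocity M a) * ω|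
      ≤ 288 * cE * Z ^ 115 := hl
    _ = Z⁻¹ * (288 * cE * Z ^ 116) := by field_simp
    _ ≤ Z⁻¹ * Real.sinh ((θ₁ / 3) ^ 4 / 4096 * Real.sqrt Λ) :=
        mul_le_mul_of_nonneg_left hsinh (inv_nonneg.2 hZ0.le)
    _ ≤ |ω| * Real.cosh ((θ₁ / 3) ^ 4 * Real.sqrt Λ' / 256) :=
        mul_le_mul hωlow hcosh (Real.sinh_nonneg_iff.2 (by positivity)) (abs_nonneg _)

end SliverBookkeeping

end Kerr

end Literature.Geometry.Lorentzian

end
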